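import Summits.QuantumFields.BalabanUV.T4Continuum.Support.NE7SharpConstrainedGradientRow
import Summits.QuantumFields.BalabanUV.T4Continuum.Support.NE7LandauLinearSup
import Summits.QuantumFields.BalabanUV.T4Continuum.Support.VariationalVectorGaugeSliceB5
import HarnessLib

/-!
# NE7EnergySliceSupFlatOfPcT — THE FLAT SUP LETTER OF THE CORNER-FREE ENERGY SLICE `𝒯_E(1)` AT `U = 1`, CLOSED MODULO ONE DISPLAYED ROW: a `Q_k`-tangent vector field `x`
# on the fine torus whose divergence is BLOCK-CONSTANT (the energy gauge) satisfies `‖x‖_∞ ≤ K·sup‖F(x)‖` (η-units; unit-lattice reading `sup‖X̃‖ ≤ K·M·sup‖curl X̃‖`),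
# uniformly in the spacing and the cubic torus, GIVEN the sup letter `‖PcT·∂ᴴ g‖_∞ ≤ C_P‖g‖_∞` for Bałaban's (1.26) projection (INTERFACE REQUEST NE7 G99-IR1)
# — memo ROAD-G99 §3.8 (A) in the kernel

Cell `pub-balaban`, rung (B)+1 sub-cell t4, lineage `b2b-balaban-t4-ne7-p1`, generation 99 (CRUX PROVER NE7 #1 = OWNER of BINDER row NE7).  Over gen 73's
`NE7LandauLinearSup` (Bałaban's Landau representative `x_B = x − ∂λ₀(∂ᴴx)` with `‖x_B‖_∞ ≤ C·sup‖F‖`, `∂ᴴx_B = P∂ᴴx` — `exists_sup_const`, `div_landau`), gen 99's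
`NE7SharpConstrainedGradientRow.sharp_sup_rows_cubic` (the sharp block-mean-constrained scalar Green's function has bounded η-gradient rows — IR2, from GAN24's (L0)∕(L2)∕`S⁻¹`),
NE2's `VariationalVectorGaugeSliceB5.PcT_LapS_of_ker` (`PΔ` kills `ker Q′`) and lit-balaban's `B5Value126.QsOp_lambda0`, `B5Action121.GradOp_conjTranspose_mul_GradOp`.

THE THREE LINES (memo §3.8 (A)).  `x ∈ ker Q_k` with `∂ᴴx = Q′*c` (energy gauge).  (1) `x = x_B + ∂μ₀`, `μ₀ = λ₀(∂ᴴx) ∈ ker Q′`, `‖x_B‖_∞ ≤ C·B` (Landau letter).  (2) `∂ᴴx_B = P∂ᴴx =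
P∂ᴴx_B + PΔμ₀ = P∂ᴴx_B`, so `‖∂ᴴx_B‖_∞ ≤ C_P·C·B` (THE DISPLAYED ROW).  (3) `Δμ₀ = ∂ᴴx − ∂ᴴx_B = Q′*c − ∂ᴴx_B` is a SHARP constrained problem with source `−∂ᴴx_B`, so
`‖∂μ₀‖_∞ ≤ C_Q·C_P·C·B` (IR2); hence `‖x‖_∞ ≤ C(1 + C_Q·C_P)·B`.  Why the displayed row is needed and why the cheaper routes are circular: memo §3.8 (A).
WHAT ([folklore]; 0 def, 0 sorry).  **`energySlice_sup_of_pcT_letter`** — for every dimension `d + 1` and every constant `C_P` making the `PcT·∂ᴴ` sup letter true on cubic tori (hypothesis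
`hP`, the body of IR1 verbatim), `∃ K > 0` such that for every `n ≥ 1`, every cubic torus `fun _ ⇒ N₀`, every `x` with `Q_k x = 0` and `∂ᴴx ∈ range Q′*`, and every `B` bounding the plaquette
field `Fs (fine n M) n x`: `‖x i‖ ≤ K·B` for all bonds `i`.  Also `landau_split` (the decomposition `x = x_B + ∂μ₀` as an identity) and `div_landau_self` (`∂ᴴx_B = P∂ᴴx_B` for `x` in the
energy gauge — in fact for every `x`).
HONEST FRAMING (page 1): CONDITIONAL on the displayed `PcT·∂ᴴ` sup letter (IR1, NOT in the tree; route located in memo §3.8: `P = G′Q′*(Q′G′²Q′*)⁻¹Q′G′`, D1BFx `RProjector.Pker`); the LP numerics of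
memo §1.4 measure the true constant (`K·` unit-conversion `= 1∕2` at `d + 1 = 3`, `3∕4` at `d + 1 = 4`, N₀ = 1); `U = 1`, flat, linear; NOT the curved letter (memo §3.7 bootstrap), NOT the
supplier, NOT NE7; spine 0∕9; finite T⁴ rung (B)+1 — NOT infinite volume, NOT mass gap, NOT BetaPertH, NOT Clay.  [B5] (1.26) and [B8] (1.38) are TEXT LOCATIONS; nothing printed is asserted.
Continuum YM on T⁴ ⇐ BetaPertH ∧ nine spine estimates (0/9 proved); BetaPertH ⇐ (D1) ∧ (D4) ∧ CAP+tail; G-an2-4 gates asym, D1 and NE2/3/4.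
-/

set_option autoImplicit false

open scoped BigOperators Matrix ComplexConjugate

namespace Summit.QuantumFields.BalabanUV.T4Continuum.NE7EnergySliceSupFlatOfPcT

open Literature.MathematicalPhysics.QuantumFieldTheory.Balaban1983to89
open B5Prop11Plancherel (Tor fine)
open B5Action121 (LapS sdiff Fs GradOp GradOp_mulVec GradOp_conjTranspose_mul_GradOp)
open B5Block118 (QsOp QvOp)
open B5Value126 (lambda0 QsOp_lambda0 PcT)
open Summit.QuantumFields.BalabanUV.Beta.GAN24.SoftMinimiserOneStepSup (blkInj)
open NE7LandauLinearSup (exists_sup_const div_landau)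
open VariationalVectorGaugeSliceB5 (PcT_LapS_of_ker)
open NE7SharpConstrainedGradientRow (sharp_sup_rows_cubic)

noncomputable section

variable {d : ℕ}

/-! ## §1 The Landau split and the self-form of Bałaban's gauge condition -/

section Split

variable (n : ℕ) [NeZero n] (M : Fin (d + 1) → ℕ) [∀ μ, NeZero (M μ)]

/-- `x = x_B + ∂μ₀` with `x_B = x − ∂λ₀(∂ᴴx)`, `μ₀ = λ₀(∂ᴴx)`. [folklore] -/
theorem landau_split (x : Tor (fine n M) × Fin (d + 1) → ℂ) :
    x = (x - GradOp (fine n M) (n : ℂ) *ᵥ lambda0 n M (n : ℂ) ((GradOp (fine n M) (n : ℂ))ᴴ *ᵥ x))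
      + GradOp (fine n M) (n : ℂ) *ᵥ lambda0 n M (n : ℂ) ((GradOp (fine n M) (n : ℂ))ᴴ *ᵥ x) := by
  rw [sub_add_cancel]

/-- `∂ᴴ(∂μ) = Δμ`. [folklore] -/
theorem div_grad (μ : Tor (fine n M) → ℂ) :
    (GradOp (fine n M) (n : ℂ))ᴴ *ᵥ (GradOp (fine n M) (n : ℂ) *ᵥ μ) = LapS (fine n M) (n : ℂ) *ᵥ μ := by
  rw [Matrix.mulVec_mulVec, GradOp_conjTranspose_mul_GradOp]

/-- `P∂ᴴx = P∂ᴴx_B`: the corrector's Laplacian is invisible to `P` (`PΔ` kills `ker Q′`, `Q′λ₀ = 0`). [folklore] -/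
theorem PcT_div_eq_PcT_div_landau (x : Tor (fine n M) × Fin (d + 1) → ℂ) :
    PcT n M (n : ℂ) *ᵥ ((GradOp (fine n M) (n : ℂ))ᴴ *ᵥ x)
      = PcT n M (n : ℂ) *ᵥ ((GradOp (fine n M) (n : ℂ))ᴴ *ᵥ
          (x - GradOp (fine n M) (n : ℂ) *ᵥ lambda0 n M (n : ℂ) ((GradOp (fine n M) (n : ℂ))ᴴ *ᵥ x))) := by
  have hc : (n : ℂ) ≠ 0 := by exact_mod_cast NeZero.ne n
  have hμ : QsOp n M *ᵥ lambda0 n M (n : ℂ) ((GradOp (fine n M) (n : ℂ))ᴴ *ᵥ x) = 0 := QsOp_lambda0 n M (n : ℂ) hc _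
  rw [Matrix.mulVec_sub, div_grad, Matrix.mulVec_sub, PcT_LapS_of_ker n M hμ, sub_zero]

/-- **`∂ᴴx_B = P∂ᴴx_B`** (Bałaban's gauge condition in self-form, every `x`). [folklore] -/
theorem div_landau_self (x : Tor (fine n M) × Fin (d + 1) → ℂ) :
    (GradOp (fine n M) (n : ℂ))ᴴ *ᵥ (x - GradOp (fine n M) (n : ℂ) *ᵥ lambda0 n M (n : ℂ) ((GradOp (fine n M) (n : ℂ))ᴴ *ᵥ x))
      = PcT n M (n : ℂ) *ᵥ ((GradOp (fine n M) (n : ℂ))ᴴ *ᵥ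
          (x - GradOp (fine n M) (n : ℂ) *ᵥ lambda0 n M (n : ℂ) ((GradOp (fine n M) (n : ℂ))ᴴ *ᵥ x))) := by
  exact (div_landau n M x).trans (PcT_div_eq_PcT_div_landau n M x)

/-- **THE CORRECTOR SOLVES A SHARP CONSTRAINED PROBLEM**: for `x` in the energy gauge (`∂ᴴx = Q′*c`), `μ₀ = λ₀(∂ᴴx)` has `Q′μ₀ = 0` and `Δμ₀ = (−∂ᴴx_B) + Q′*c`. [folklore] -/
theorem corrector_sharp {x : Tor (fine n M) × Fin (d + 1) → ℂ} {c : Tor M → ℂ}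
    (hE : (GradOp (fine n M) (n : ℂ))ᴴ *ᵥ x = blkInj n M *ᵥ c) :
    QsOp n M *ᵥ lambda0 n M (n : ℂ) ((GradOp (fine n M) (n : ℂ))ᴴ *ᵥ x) = 0 ∧
    LapS (fine n M) (n : ℂ) *ᵥ lambda0 n M (n : ℂ) ((GradOp (fine n M) (n : ℂ))ᴴ *ᵥ x)
      = -((GradOp (fine n M) (n : ℂ))ᴴ *ᵥ (x - GradOp (fine n M) (n : ℂ) *ᵥ lambda0 n M (n : ℂ) ((GradOp (fine n M) (n : ℂ))ᴴ *ᵥ x)))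
        + blkInj n M *ᵥ c := by
  have hc : (n : ℂ) ≠ 0 := by exact_mod_cast NeZero.ne n
  refine ⟨QsOp_lambda0 n M (n : ℂ) hc _, ?_⟩
  rw [Matrix.mulVec_sub, div_grad, hE]
  abel

end Split

/-! ## §2 The flat energy-slice sup letter, modulo the `PcT·∂ᴴ` row -/

/-- **THE FLAT SUP LETTER OF `𝒯_E(1)` MODULO THE `PcT·∂ᴴ` SUP ROW (memo §3.8 (A))**: let `C_P` make the sup letter `‖(P∂ᴴg)(y)‖ ≤ C_P·‖g‖_∞` true on every cubic torus and every
spacing (hypothesis `hP` = INTERFACE REQUEST NE7 G99-IR1 verbatim).  Then `∃ K > 0` (a function of `d`, `C_P`) such that for every `n ≥ 1`, every cubic unit torus `fun _ ⇒ N₀`, every vector field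
`x` with `Q_k x = 0` whose divergence is block-constant (`∂ᴴx = Q′*c`), and every `B` bounding its plaquette field: `‖x i‖ ≤ K·B` for every bond `i`. [folklore] -/
theorem energySlice_sup_of_pcT_letter (d : ℕ) {C_P : ℝ}
    (hP : ∀ (n N₀ : ℕ) [NeZero n] [NeZero N₀], 1 ≤ n →
      ∀ (g : Tor (fine n (fun _ : Fin (d + 1) => N₀)) × Fin (d + 1) → ℂ) (b : ℝ), (∀ i, ‖g i‖ ≤ b) →
        ∀ y, ‖(PcT n (fun _ : Fin (d + 1) => N₀) (n : ℂ) *ᵥ ((GradOp (fine n (fun _ : Fin (d + 1) => N₀)) (n : ℂ))ᴴ *ᵥ g)) y‖ ≤ C_P * b) :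
    ∃ K : ℝ, 0 < K ∧ ∀ (n N₀ : ℕ) [NeZero n] [NeZero N₀], 1 ≤ n →
      ∀ (x : Tor (fine n (fun _ : Fin (d + 1) => N₀)) × Fin (d + 1) → ℂ), QvOp n (fun _ : Fin (d + 1) => N₀) *ᵥ x = 0 →
        (∃ c : Tor (fun _ : Fin (d + 1) => N₀) → ℂ, (GradOp (fine n (fun _ : Fin (d + 1) => N₀)) (n : ℂ))ᴴ *ᵥ x = blkInj n (fun _ : Fin (d + 1) => N₀) *ᵥ c) →
        ∀ B : ℝ, (∀ (μ ν : Fin (d + 1)) (t : Tor (fine n (fun _ : Fin (d + 1) => N₀))), ‖Fs (fine n (fun _ : Fin (d + 1) => N₀)) (n : ℂ) x μ ν t‖ ≤ B) →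
          ∀ i, ‖x i‖ ≤ K * B := by
  obtain ⟨C, hC, hB⟩ := exists_sup_const (d := d)
  obtain ⟨C_Q, hC_Q, hQ⟩ := sharp_sup_rows_cubic d
  refine ⟨C * (1 + C_Q * max C_P 0), by positivity, fun n N₀ _ _ hn x hQv hE B hFs i => ?_⟩
  obtain ⟨c, hc⟩ := hE
  have hB0 : 0 ≤ B := (norm_nonneg _).trans (hFs 0 0 0)
  have hCB : 0 ≤ C * B := by positivity
  -- (1) the Landau representative `x_B` is bounded
  have h1 := hB n (fun _ : Fin (d + 1) => N₀) x hQv B hFs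
  -- (2) its divergence is `P` of itself, hence bounded by the displayed row
  have h2 : ∀ y, ‖(-((GradOp (fine n (fun _ : Fin (d + 1) => N₀)) (n : ℂ))ᴴ *ᵥ
      (x - GradOp (fine n (fun _ : Fin (d + 1) => N₀)) (n : ℂ) *ᵥ lambda0 n (fun _ : Fin (d + 1) => N₀) (n : ℂ)
        ((GradOp (fine n (fun _ : Fin (d + 1) => N₀)) (n : ℂ))ᴴ *ᵥ x)))) y‖ ≤ max C_P 0 * (C * B) := by
    intro y
    rw [Pi.neg_apply, norm_neg, div_landau_self n (fun _ : Fin (d + 1) => N₀) x]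
    exact (hP n N₀ hn _ _ h1 y).trans (mul_le_mul_of_nonneg_right (le_max_left _ _) hCB)
  -- (3) the corrector solves a sharp constrained problem with that source: bounded η-gradient
  obtain ⟨hμQ, hμL⟩ := corrector_sharp n (fun _ : Fin (d + 1) => N₀) hc
  have h3 := (hQ n N₀ hn _ _ c _ h2 hμQ hμL).2.2
  -- sum
  obtain ⟨t, ν⟩ := i
  have hsplit := congrFun (landau_split n (fun _ : Fin (d + 1) => N₀) x) (t, ν)
  rw [Pi.add_apply, GradOp_mulVec] at hsplit
  rw [hsplit]
  refine (norm_add_le _ _).trans ?_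
  have e : C * (1 + C_Q * max C_P 0) * B = C * B + C_Q * (max C_P 0 * (C * B)) := by ring
  rw [e]
  exact add_le_add (h1 _) (h3 ν t)

end

end Summit.QuantumFields.BalabanUV.T4Continuum.NE7EnergySliceSupFlatOfPcT
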